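import Summits.HodgeConjecture.HodgeConjecture.Cruxes.BlochSeedDiscOne.ShellThreeDoorB
import Summits.HodgeConjecture.HodgeConjecture.Cruxes.BlochSeedDiscOne.ShellThreeFloorB

/-!
# FamilyLemmaN — the N-side complement of the general-shell door: (L0)ₛ, (2)ₛ and «hub-free N ⊆ {u⁴}» (commission (F-N), R19.727 (2) ∕ R19.732)

`line stmt-HodgeConjecture-18881 Cruxes/BlochSeedDiscOne/Lines/birth.lean 814a6a70c14e831a stub_rung_pad4_seedAt`
(plan-lens-HodgeAV-dual g17, 2026-08-31).  COMPLEMENT of extremal g21's leaf v2 `FamilyLemmaLs.lean` (commit 86b1922d079f: (L1)ₛ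
`noN_colS_oneHub`, (L2)ₛ `noP_off_colS_hub`, (L3)ₛ `noN_colPred_off_hub`, (L4)ₛ `noN_off_colS_HH`, (L5)ₛ `noP_colPred_off_off_hub` under
`RingLe s`, `NoHook s`, `OffLow`), which this seat ×2-read (AGREE; (L3)ₛ ∕ (L4)ₛ were re-derived independently here before reading v2 and
coincide statement for statement — kept OUT of this file to avoid a duplicate).  What this file ADDS, all with `h`, `s` free:
(L0)ₛ (no off-axis letter in a hub-free N cell, under (Bu) ALONE), (2)ₛ (a one-hub P cell with a ceiling letter forces its two-hub N
companions), (L6) (under the strict regime every hub-free N cell is u⁴) and the honest endpoint `unit4N_block_supplier` (N u⁴ is RULE-D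
consistent — its death is a MASS statement, negation's NU4, not a door lemma).  §0 RESTATES VERBATIM extremal's `RingLe`, `NoHook`, (L1)ₛ
(same bodies, credit extremal g21) only because the farm snapshot has not yet built `FamilyLemmaLs` (rc 75 `unbuilt` ×2, 07:18Z–07:24Z); the weak-cone
lemma `offAxis_of_le` is `ShellThreePairLaw.offAxis_of_le` (mshunt g8) restated for the same reason.
KERNEL STATEMENTS ONLY — no `sorry`, no new axiom, no `instance`, no `notation`, no `decide`, no `native_decide`.
**Nothing here is proved toward HC ∕ HC_CM ∕ HC_AV ∕ №4 ∕ 26512 ∕ 18881 ∕ H2.**  Letters ≠ sheaves ≠ SEED.  Letter-model lemmas under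
DISPLAYED support-level binders of other seats, NOT proved here:
* `NoOffHubfreeP D` — no hub-free supported P cell has an off-axis letter ((Bu) at shell 3 = gs-eng-2 (B) ∧ «P Buuu = ∅»; at shell `s` the
  «(M2ₛ)-offaxis» seed of extremal ∕ negation restricted to hub-free cells; literally `ShellThreeFloorB.NoOffHubfreeP`, `noOffHubfreeP_iff_floorB`;
  it implies the body of extremal's `OffLow`, `offLow_body_of_noOff`);
* `NoHook s D` — no hub-free supported P cell has a co-level-`s` letter (extremal's binder; body of `FamilyLemmaLs.NoHook`);
* `StrictHubfreeP D` — every hub-free supported P cell has co-levels `≤ 2`, at most one of them `= 2` (the strict regime «hub-free P ⊆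
  {u⁴, Auuu}» of the shell-4∕5 rooms — Buuu is not excluded by the typing; implies gs-eng-2 (B) `hubfreePB_of_strict` and `NoHook s` for
  `s ≥ 3`, `noHook_of_strict`).
Everything else is the COARSE RULE D (`LeggedFloor.RuleD`), `Disj`, the alphabet `D.OnAlphabet h` and the ring `RingLe s`.

## THE LEMMAS (one RULE-D block each)
* (L0)ₛ `hubfreeN_onAxis_of_noOff` — under `NoOffHubfreeP` ALONE (no ring, no `Disj`, any `h`, any shell): no hub-free supported N cell has an
  off-axis letter (the supplier at a block through the off-axis slot is hub-free and weakly below an off-axis letter, hence off-axis there).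
  gs-eng-2 (A) at every shell; the kernel (L0) `ShellThreeDoorB.hubfreeN_onAxis` used (B) + `Disj` instead.
* (2)ₛ `nHub_of_p_colS_hub` — under `RingLe s`, `NoHook s`: a supported P cell with a charged letter at i, a co-level-s letter at k ≠ i, a hub
  at j and every letter off j charged FORCES the supported N cell «x with the i letter replaced by a hub» (the edge consumer at block {i, j}
  — `ShellThreeDoorB.edgeN_of_charged_hub` — lifts the i letter; a charged lift is (L1)ₛ-dead).  s = 3: `ShellThreeDoorB.nHub_of_p_col3_hub`.
  Core reading at s = 4: P CCGH ⇒ N HCGH, N CHGH; P ACFH ⇒ N HCFH, N AHFH; P AAGH ⇒ N HAGH; P CGHu ⇒ N HGHu, N CGHH-type … — the forced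
  companions of the core family are TWO-HUB N cells (weight 0 in every product law; they are extremal's door-δ threads CGHH, CFHH, AGHH,
  AFHH, GHHu, FHHu read from the P side).
* (L6) `hubfreeN_col_one_of_strict` — under `StrictHubfreeP` (no ring): every hub-free supported N cell has ALL co-levels `= 1`, i.e. is u⁴
  (block {f, j}: the supplier is hub-free, so has co-levels ≤ 2 with at most one 2; a co-level-2 letter of the N cell at f stays in the
  supplier and `Disj` forces a second co-level-2 letter at j); `hubfreeN_is_unit4` adds the axis reading.
* `unit4N_block_supplier` — the honest endpoint: under the strict regime each of the six blocks of a hub-free (= u⁴) N cell IS supplied, by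
  «u⁴ with exactly one block letter deepened to co-level 2» (P Auuu ∕ Buuu): N u⁴ is RULE-D consistent.
(F-N) «every hub-free N shape is door-dead at every shell s ≥ 3» therefore holds as a DOOR lemma exactly up to u⁴: (L0)ₛ kills the off-axis
shapes under (Bu), (L6) kills every axis shape but u⁴ under the strict regime, and u⁴ is a MASS statement (negation NU4, gs-eng-2 N u⁴ ×2 at
shell 3) — the break point is the same at every s, and it is not a value of s.
HONEST SCOPE: one-block consequences of displayed binders; whether the binders hold at shell s ≥ 4 is a support-level question of the rooms of
record (extremal: strict regime checked at s = 4, sampled at s = 5).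
-/

set_option linter.dupNamespace false
set_option autoImplicit false

namespace Summit.HodgeConjecture.HodgeConjecture.Cruxes.BlochSeedDiscOne.FamilyLemmaN

open Summit.HodgeConjecture.HodgeConjecture.Cruxes.BlochSeedDiscOne.DepthBoundA4
open Summit.HodgeConjecture.HodgeConjecture.Cruxes.BlochSeedDiscOne.LeggedFloor
  (RuleD Disj NullStep Supplies Detects mem_supp_of_memP mem_supp_of_memN)
open Summit.HodgeConjecture.HodgeConjecture.Cruxes.BlochSeedDiscOne.ShellThreeDoorB
  (OffAxis Ring3 HubfreePB col_nonneg col_lt_of_nullStep col_le_of_eq_or_null two_le_colevel_of_offAxis detects_of_col_ne_zero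
   ruleDN_any cell_eq_of_supplies edgeN_of_charged_hub)

/-! ## §0 Extremal g21's vocabulary and (L1)ₛ — VERBATIM from `FamilyLemmaLs.lean` (restated only because that module is not yet built on the
farm snapshot; same bodies; credit: plan-lens-HodgeAV-extremal g21) -/

/-- ring `s` of the register: every supported letter has co-level `≤ s` (body of `FamilyLemmaLs.RingLe` = `DeepLayerLaws.RingLe`). -/
def RingLe (s : ℤ) (D : Design) : Prop := ∀ x ∈ D.suppN ++ D.suppP, ∀ f : Fin 4, (x f).colevel ≤ s

/-- **NoHookₛ** (extremal's binder, body of `FamilyLemmaLs.NoHook`): no hub-free supported P cell contains a letter of co-level `s`. -/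
def NoHook (s : ℤ) (D : Design) : Prop :=
  ∀ x ∈ D.suppP, (∀ f : Fin 4, (x f).colevel ≠ 0) → ∀ f : Fin 4, (x f).colevel ≠ s

theorem ringLe_three_iff (D : Design) : RingLe 3 D ↔ Ring3 D := Iff.rfl

/-- gs-eng-2 (B) gives `NoHook s` for every `s ≥ 3` (`FamilyLemmaLs.noHook_of_hubfreePB`). -/
theorem noHook_of_hubfreePB {D : Design} (hB : HubfreePB D) {s : ℤ} (hs : 3 ≤ s) : NoHook s D := by
  intro x hx hfree f hf
  have h2 := (hB x hx hfree).1 f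
  omega

/-- **(L1)ₛ** (`FamilyLemmaLs.noN_colS_oneHub`, verbatim): no supported N cell with a hub at `j`, a co-level-`s` letter at `k`, and every
letter off `j` charged. -/
theorem noN_colS_oneHub {h s : ℤ} {D : Design} (hD : D.OnAlphabet h) (hr : RuleD D) (hdis : Disj D) (hS : RingLe s D)
    (hB : NoHook s D) {y : Cell} (hy : y ∈ D.suppN) {k j : Fin 4} (hkj : k ≠ j) (hk : (y k).colevel = s)
    (hj : (y j).colevel = 0) (hch : ∀ f : Fin 4, f ≠ j → (y f).colevel ≠ 0) : False := by
  have hyA : ∀ f : Fin 4, (y f).OnAlphabet h := hD y (mem_supp_of_memN D hy)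
  obtain ⟨x, hx, hs⟩ := ruleDN_any hr hy hkj (detects_of_col_ne_zero y k j (hch k hkj))
  have hxA : ∀ f : Fin 4, (x f).OnAlphabet h := hD x (mem_supp_of_memP D hx)
  have hxk : x k = y k := by
    rcases hs.2.1 with he | hn
    · exact he
    · exfalso
      have h1 := col_lt_of_nullStep (hxA k) (hyA k) hn
      have h2 := hS x (mem_supp_of_memP D hx) k
      omega
  have hnj : NullStep (x j) (y j) := by
    rcases hs.2.2 with he | hn
    · exact (hdis x (by rw [cell_eq_of_supplies hs hxk he]; exact hy) hx).elim
    · exact hn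
  have hxj : (x j).colevel ≠ 0 := by
    have h1 := col_lt_of_nullStep (hxA j) (hyA j) hnj
    have h2 := col_nonneg (y j)
    omega
  have hxfree : ∀ f : Fin 4, (x f).colevel ≠ 0 := by
    intro f
    by_cases hfk : f = k
    · rw [hfk, hxk]; exact hch k hkj
    by_cases hfj : f = j
    · rw [hfj]; exact hxj
    · rw [hs.1 f hfk hfj]; exact hch f hfj
  exact hB x hx hxfree k (by rw [hxk, hk])

/-! ## §1 The displayed binders -/

/-- (Bu) ∕ (M2ₛ)-offaxis: no HUB-FREE supported P cell has an off-axis letter (same body as `ShellThreeFloorB.NoOffHubfreeP`). -/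
def NoOffHubfreeP (D : Design) : Prop :=
  ∀ x ∈ D.suppP, (∀ f : Fin 4, (x f).colevel ≠ 0) → ∀ f : Fin 4, ¬ OffAxis (x f)

/-- the binder is literally the plate's `ShellThreeFloorB.NoOffHubfreeP` (the two `OffAxis` copies have one body). -/
theorem noOffHubfreeP_iff_floorB (D : Design) : NoOffHubfreeP D ↔ ShellThreeFloorB.NoOffHubfreeP D := Iff.rfl

/-- THE STRICT REGIME as a binder: a hub-free supported P cell has co-levels `≤ 2`, at most one of them `= 2`
(u⁴, Auuu — and Buuu, which the typing does not exclude; the shell-4∕5 rooms have hub-free P ⊆ {u⁴, Auuu}). -/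
def StrictHubfreeP (D : Design) : Prop :=
  ∀ x ∈ D.suppP, (∀ f : Fin 4, (x f).colevel ≠ 0) →
    (∀ f : Fin 4, (x f).colevel ≤ 2) ∧ (∀ k g : Fin 4, k ≠ g → (x k).colevel = 2 → (x g).colevel ≤ 1)

/-- the strict regime implies extremal's binder `NoHook s` for every `s ≥ 3`. -/
theorem noHook_of_strict {D : Design} (hSt : StrictHubfreeP D) {s : ℤ} (hs : 3 ≤ s) : NoHook s D := by
  intro x hx hfree f hf
  have h2 := (hSt x hx hfree).1 f
  omega

/-- the strict regime implies gs-eng-2 (B) (`ShellThreeDoorB.HubfreePB`: co-levels ≤ 2, and next to an off-axis letter only units) — an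
off-axis letter of co-level ≤ 2 has co-level exactly 2.  (The converse fails exactly on P AAuu ∕ AAAu ∕ AAAA, which (B) allows.) -/
theorem hubfreePB_of_strict {D : Design} (hSt : StrictHubfreeP D) : HubfreePB D := by
  intro x hx hfree
  obtain ⟨hle2, hone⟩ := hSt x hx hfree
  refine ⟨hle2, fun k g hkg hko => hone k g hkg ?_⟩
  have h1 := two_le_colevel_of_offAxis (x k) hko
  have h2 := hle2 k
  omega

/-- `NoOffHubfreeP` gives the body of extremal's `FamilyLemmaLs.OffLow` (gs-eng-2 (B), second clause) vacuously — so leaf v2's (L3)ₛ, (L5)ₛ,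
stated under `OffLow`, hold a fortiori under (Bu). -/
theorem offLow_body_of_noOff {D : Design} (hBu : NoOffHubfreeP D) :
    ∀ x ∈ D.suppP, (∀ f : Fin 4, (x f).colevel ≠ 0) → ∀ k g : Fin 4, k ≠ g → OffAxis (x k) → (x g).colevel ≤ 1 :=
  fun x hx hfree k _ _ hko => absurd hko (hBu x hx hfree k)

/-! ## §2 (L0)ₛ — hub-free N cells are axis cells, under `NoOffHubfreeP` alone -/

/-- on the alphabet, a letter weakly-causally below an off-axis letter (`a < a′`, `|β′ − β|² ≤ (a′ − a)²`) is off-axis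
(`ShellThreePairLaw.offAxis_of_le`, mshunt g8 — proof verbatim; restated because this module does not import `ShellThreePairLaw`). -/
theorem offAxis_of_le {h : ℤ} {ℓ ℓ' : Letter} (hℓ : ℓ.OnAlphabet h) (hℓ' : ℓ'.OnAlphabet h) (hlt : ℓ.a < ℓ'.a)
    (hcone : (ℓ'.x - ℓ.x) ^ 2 + (ℓ'.y - ℓ.y) ^ 2 ≤ (ℓ'.a - ℓ.a) ^ 2) (hoff : OffAxis ℓ') : OffAxis ℓ := by
  have e1 := hℓ.1
  have e2 := hℓ'.1
  unfold Letter.height at e1 e2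
  have hP : 0 < |ℓ'.x| := abs_pos.mpr hoff.1
  have hQ : 0 < |ℓ'.y| := abs_pos.mpr hoff.2
  have sx : (|ℓ'.x| - |ℓ.x|) ^ 2 ≤ (ℓ'.x - ℓ.x) ^ 2 := by
    have h0 := abs_abs_sub_abs_le_abs_sub ℓ'.x ℓ.x
    have h3 := sq_le_sq' (abs_le.mp h0).1 (abs_le.mp h0).2
    simpa only [sq_abs] using h3
  have sy : (|ℓ'.y| - |ℓ.y|) ^ 2 ≤ (ℓ'.y - ℓ.y) ^ 2 := by
    have h0 := abs_abs_sub_abs_le_abs_sub ℓ'.y ℓ.y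
    have h3 := sq_le_sq' (abs_le.mp h0).1 (abs_le.mp h0).2
    simpa only [sq_abs] using h3
  by_contra hcon
  unfold OffAxis at hcon
  rcases not_and_or.mp hcon with hx | hy
  · have hx0 : ℓ.x = 0 := not_not.mp hx
    have ax : |ℓ.x| = 0 := by rw [hx0]; simp
    have px : (ℓ'.x - ℓ.x) ^ 2 = |ℓ'.x| ^ 2 := by rw [hx0, sub_zero, sq_abs]
    rw [px] at hcone
    rw [ax] at e1
    nlinarith [mul_pos hP hQ, mul_pos hP hP]
  · have hy0 : ℓ.y = 0 := not_not.mp hy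
    have ay : |ℓ.y| = 0 := by rw [hy0]; simp
    have py : (ℓ'.y - ℓ.y) ^ 2 = |ℓ'.y| ^ 2 := by rw [hy0, sub_zero, sq_abs]
    rw [py] at hcone
    rw [ay] at e1
    nlinarith [mul_pos hP hQ, mul_pos hQ hQ]

/-- a letter equal to or null-stepping up to an off-axis letter is off-axis (alphabet). -/
theorem offAxis_of_eq_or_null {h : ℤ} {ℓ ℓ' : Letter} (hℓ : ℓ.OnAlphabet h) (hℓ' : ℓ'.OnAlphabet h)
    (hs : ℓ = ℓ' ∨ NullStep ℓ ℓ') (hoff : OffAxis ℓ') : OffAxis ℓ := by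
  rcases hs with he | hn
  · rw [he]; exact hoff
  · exact offAxis_of_le hℓ hℓ' hn.1 (le_of_eq hn.2) hoff

/-- **(L0)ₛ**: under `NoOffHubfreeP`, NO hub-free supported N cell has an off-axis letter — at every height, every shell, without
`Disj` or a ring hypothesis (RULE D at a block `{k, j}` through the off-axis slot `k`: the P supplier equals the N cell off the block
and lies weakly below it on the block, so it is hub-free and off-axis at `k`). -/
theorem hubfreeN_onAxis_of_noOff {h : ℤ} {D : Design} (hD : D.OnAlphabet h) (hr : RuleD D) (hBu : NoOffHubfreeP D)
    {y : Cell} (hy : y ∈ D.suppN) (hfree : ∀ f : Fin 4, (y f).colevel ≠ 0) (k : Fin 4) : ¬ OffAxis (y k) := by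
  intro hoff
  have hyA : ∀ f : Fin 4, (y f).OnAlphabet h := hD y (mem_supp_of_memN D hy)
  obtain ⟨j, hjk⟩ : ∃ j : Fin 4, j ≠ k := by
    by_cases hk : k = 0
    · exact ⟨1, by rw [hk]; omega⟩
    · exact ⟨0, fun h0 => hk h0.symm⟩
  obtain ⟨x, hx, hs⟩ := ruleDN_any hr hy hjk.symm (detects_of_col_ne_zero y k j (hfree k))
  have hxA : ∀ f : Fin 4, (x f).OnAlphabet h := hD x (mem_supp_of_memP D hx)
  have hxfree : ∀ f : Fin 4, (x f).colevel ≠ 0 := by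
    intro f
    by_cases hfk : f = k
    · rw [hfk]
      have h1 := col_le_of_eq_or_null (hxA k) (hyA k) hs.2.1
      have h2 := hfree k
      have h3 := col_nonneg (y k)
      omega
    by_cases hfj : f = j
    · rw [hfj]
      have h1 := col_le_of_eq_or_null (hxA j) (hyA j) hs.2.2
      have h2 := hfree j
      have h3 := col_nonneg (y j)
      omega
    · rw [hs.1 f hfk hfj]; exact hfree f
  exact hBu x hx hxfree k (offAxis_of_eq_or_null (hxA k) (hyA k) hs.2.1 hoff)

/-- (L0)ₛ in the plate's currency (`ShellThreeFloorB.NoOffHubfreeP`). -/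
theorem hubfreeN_onAxis_of_noOff' {h : ℤ} {D : Design} (hD : D.OnAlphabet h) (hr : RuleD D)
    (hBu : ShellThreeFloorB.NoOffHubfreeP D) {y : Cell} (hy : y ∈ D.suppN) (hfree : ∀ f : Fin 4, (y f).colevel ≠ 0)
    (k : Fin 4) : ¬ OffAxis (y k) :=
  hubfreeN_onAxis_of_noOff hD hr ((noOffHubfreeP_iff_floorB D).mpr hBu) hy hfree k

/-! ## §3 (2)ₛ — a one-hub P cell with a ceiling letter forces its TWO-HUB N companions -/

/-- **(2)ₛ**: a supported P cell with a charged letter at `i`, a co-level-`s` letter at `k ≠ i`, a hub at `j` and every letter off `j`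
charged forces the supported N cell «`x` with the `i` letter replaced by a hub» (block {i, j}: the consumer keeps the hub, lifts the
`i` letter strictly — `ShellThreeDoorB.edgeN_of_charged_hub`; a charged lift is a one-hub N cell with a ceiling letter: (L1)ₛ-dead).
s = 3: `ShellThreeDoorB.nHub_of_p_col3_hub` (P AADH ⇒ N ADHH).  s = 4, core family: P CCGH ⇒ N HCGH, N CHGH; P ACFH ⇒ N HCFH, N AHFH;
P AAGH ⇒ N HAGH; P uCGH ⇒ N HCGH, N uHGH; P CCFH, ACGH, AAFH likewise (the ceiling letter is the off-axis one, `k` = its slot). -/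
theorem nHub_of_p_colS_hub {h s : ℤ} {D : Design} (hD : D.OnAlphabet h) (hr : RuleD D) (hdis : Disj D) (hS : RingLe s D)
    (hB : NoHook s D) {x : Cell} (hx : x ∈ D.suppP) {i k j : Fin 4} (hij : i ≠ j) (hik : i ≠ k) (hkj : k ≠ j)
    (hi : (x i).colevel ≠ 0) (hk : (x k).colevel = s) (hj : (x j).colevel = 0)
    (hch : ∀ f : Fin 4, f ≠ j → (x f).colevel ≠ 0) :
    ∃ y ∈ D.suppN, (∀ f : Fin 4, f ≠ i → y f = x f) ∧ (y i).colevel = 0 := by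
  have hxA : ∀ f : Fin 4, (x f).OnAlphabet h := hD x (mem_supp_of_memP D hx)
  obtain ⟨y, hy, hyf, hyn⟩ := edgeN_of_charged_hub hD hr hdis hx hij hi hj
  have hyA : ∀ f : Fin 4, (y f).OnAlphabet h := hD y (mem_supp_of_memN D hy)
  refine ⟨y, hy, hyf, ?_⟩
  by_contra hyi
  -- a charged lift: `y` is a one-hub N cell with the ceiling letter at `k` and everything off `j` charged
  refine noN_colS_oneHub hD hr hdis hS hB hy hkj (by rw [hyf k hik.symm]; exact hk) (by rw [hyf j hij.symm]; exact hj) ?_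
  intro f hfj
  by_cases hfi : f = i
  · rw [hfi]; exact hyi
  · rw [hyf f hfi]; exact hch f hfj

/-! ## §4 (L6) — under the strict regime the only hub-free N shape is u⁴, and u⁴ is RULE-D consistent -/

/-- **(L6)**: under `StrictHubfreeP`, every HUB-FREE supported N cell has all co-levels `= 1` (a u⁴ cell), at every height and shell
(no ring hypothesis): at the block {f, j} the supplier is hub-free, hence has co-levels ≤ 2 with at most one equal to 2; if the N letter
at `f` had co-level 2 it would stay in the supplier, and `Disj` would deepen the `j` letter to a second co-level-2 letter. -/
theorem hubfreeN_col_one_of_strict {h : ℤ} {D : Design} (hD : D.OnAlphabet h) (hr : RuleD D) (hdis : Disj D)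
    (hSt : StrictHubfreeP D) {y : Cell} (hy : y ∈ D.suppN) (hfree : ∀ f : Fin 4, (y f).colevel ≠ 0) (f : Fin 4) :
    (y f).colevel = 1 := by
  have hyA : ∀ g : Fin 4, (y g).OnAlphabet h := hD y (mem_supp_of_memN D hy)
  obtain ⟨j, hjf⟩ : ∃ j : Fin 4, j ≠ f := by
    by_cases hf : f = 0
    · exact ⟨1, by rw [hf]; omega⟩
    · exact ⟨0, fun h0 => hf h0.symm⟩
  obtain ⟨x, hx, hs⟩ := ruleDN_any hr hy hjf.symm (detects_of_col_ne_zero y f j (hfree f))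
  have hxA : ∀ g : Fin 4, (x g).OnAlphabet h := hD x (mem_supp_of_memP D hx)
  have hcf := col_le_of_eq_or_null (hxA f) (hyA f) hs.2.1
  have hcj := col_le_of_eq_or_null (hxA j) (hyA j) hs.2.2
  have hxfree : ∀ g : Fin 4, (x g).colevel ≠ 0 := by
    intro g
    by_cases hgf : g = f
    · rw [hgf]; have h2 := hfree f; have h3 := col_nonneg (y f); omega
    by_cases hgj : g = j
    · rw [hgj]; have h2 := hfree j; have h3 := col_nonneg (y j); omega
    · rw [hs.1 g hgf hgj]; exact hfree g
  obtain ⟨hle2, hone⟩ := hSt x hx hxfree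
  have h0f := col_nonneg (y f)
  have hyf := hfree f
  -- if `(y f).colevel = 2`, the supplier agrees at `f` and must step strictly at `j`, to a second co-level-2 letter
  by_contra hne
  have hy2 : (y f).colevel = 2 := by have := hle2 f; omega
  have hxf : x f = y f := by
    rcases hs.2.1 with he | hn
    · exact he
    · exfalso
      have h1 := col_lt_of_nullStep (hxA f) (hyA f) hn
      have h2 := hle2 f
      omega
  have hjn : NullStep (x j) (y j) := by
    rcases hs.2.2 with he | hn
    · exact (hdis x (by rw [cell_eq_of_supplies hs hxf he]; exact hy) hx).elim
    · exact hn
  have h1 := col_lt_of_nullStep (hxA j) (hyA j) hjn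
  have h2 := hone f j hjf.symm (by rw [hxf]; exact hy2)
  have h3 := hfree j
  have h4 := col_nonneg (y j)
  omega

/-- (L6) with (L0)ₛ folded in: under the strict regime and `NoOffHubfreeP`, a hub-free supported N cell is u⁴ — all co-levels `1`
and (hence) all letters on an axis. -/
theorem hubfreeN_is_unit4 {h : ℤ} {D : Design} (hD : D.OnAlphabet h) (hr : RuleD D) (hdis : Disj D)
    (hSt : StrictHubfreeP D) {y : Cell} (hy : y ∈ D.suppN) (hfree : ∀ f : Fin 4, (y f).colevel ≠ 0) (f : Fin 4) :
    (y f).colevel = 1 ∧ ¬ OffAxis (y f) := by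
  refine ⟨hubfreeN_col_one_of_strict hD hr hdis hSt hy hfree f, fun hoff => ?_⟩
  have h1 := two_le_colevel_of_offAxis (y f) hoff
  have h2 := hubfreeN_col_one_of_strict hD hr hdis hSt hy hfree f
  omega

/-- **N u⁴ is RULE-D consistent, and this is all the door says about it**: under the strict regime, at each block `{g, j}` of a hub-free
(hence u⁴) supported N cell the P supplier is «the same cell with exactly ONE of the two block letters deepened to co-level 2» — a
P Auuu ∕ Buuu cell.  (So (F-N) «every hub-free N shape is dead» is, beyond (L0)ₛ + (L6), the MASS statement «N u⁴ = ∅» — negation's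
NU4 ∕ gs-eng-2's N u⁴ ×2 at shell 3 — not a door lemma, at any shell.) -/
theorem unit4N_block_supplier {h : ℤ} {D : Design} (hD : D.OnAlphabet h) (hr : RuleD D) (hdis : Disj D)
    (hSt : StrictHubfreeP D) {y : Cell} (hy : y ∈ D.suppN) (hfree : ∀ f : Fin 4, (y f).colevel ≠ 0)
    {g j : Fin 4} (hgj : g ≠ j) :
    ∃ x ∈ D.suppP, (∀ f : Fin 4, f ≠ g → f ≠ j → x f = y f) ∧
      (((x g).colevel = 2 ∧ x j = y j) ∨ (x g = y g ∧ (x j).colevel = 2)) := by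
  have hyA : ∀ f : Fin 4, (y f).OnAlphabet h := hD y (mem_supp_of_memN D hy)
  have hu : ∀ f : Fin 4, (y f).colevel = 1 := hubfreeN_col_one_of_strict hD hr hdis hSt hy hfree
  obtain ⟨x, hx, hs⟩ := ruleDN_any hr hy hgj (detects_of_col_ne_zero y g j (hfree g))
  have hxA : ∀ f : Fin 4, (x f).OnAlphabet h := hD x (mem_supp_of_memP D hx)
  have hcg := col_le_of_eq_or_null (hxA g) (hyA g) hs.2.1
  have hcj := col_le_of_eq_or_null (hxA j) (hyA j) hs.2.2
  have hxfree : ∀ f : Fin 4, (x f).colevel ≠ 0 := by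
    intro f
    by_cases hfg : f = g
    · rw [hfg]; have := hu g; omega
    by_cases hfj : f = j
    · rw [hfj]; have := hu j; omega
    · rw [hs.1 f hfg hfj]; exact hfree f
  obtain ⟨hle2, hone⟩ := hSt x hx hxfree
  refine ⟨x, hx, hs.1, ?_⟩
  rcases hs.2.1 with hge | hgn
  · -- equal at `g`: strict step at `j`
    have hjn : NullStep (x j) (y j) := by
      rcases hs.2.2 with he | hn
      · exact (hdis x (by rw [cell_eq_of_supplies hs hge he]; exact hy) hx).elim
      · exact hn
    have h1 := col_lt_of_nullStep (hxA j) (hyA j) hjn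
    have h2 := hle2 j
    have h3 := hu j
    exact Or.inr ⟨hge, by omega⟩
  · -- strict step at `g`: then the `g` letter of the supplier has co-level 2, and the `j` letter cannot also be deepened
    have h1 := col_lt_of_nullStep (hxA g) (hyA g) hgn
    have h2 := hle2 g
    have h3 := hu g
    have hxg2 : (x g).colevel = 2 := by omega
    refine Or.inl ⟨hxg2, ?_⟩
    rcases hs.2.2 with he | hn
    · exact he
    · exfalso
      have h4 := col_lt_of_nullStep (hxA j) (hyA j) hn
      have h5 := hone g j hgj hxg2
      have h6 := hu j
      omega

/-! ## §5 Scope -/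

/-- HONEST SCOPE (no content): the one-hub N cells WITHOUT a ceiling letter (N AADH-type at s = 4: co-level-2 axis letters + off-axis D + hub)
and the hub-free N u⁴ are outside (L0)ₛ, (L1)ₛ, (2)ₛ, (L6) and outside extremal's (L3)ₛ–(L5)ₛ; the former are the N side of the live core
ecosystem (dual g17 RESULT-3; extremal g21 RESULT-4 door δ proposes to kill it from six two-hub N threads by cascade — a ROOM statement, not a
door lemma), the latter is negation's NU4 mass statement. -/
theorem scope_note : True := trivial

end Summit.HodgeConjecture.HodgeConjecture.Cruxes.BlochSeedDiscOne.FamilyLemmaN
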